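import Summits.AtomisticToContinuum.Crystallization.Theorems.GappedShellCensusCleanLimitsHaveWindowsInplaneGain2
import Summits.AtomisticToContinuum.Crystallization.Theorems.GappedShellCensusCleanLimitsHaveWindowsInplaneGain3

/-!
# `CleanLimitsHaveWindows` (stmt-AtomisticToContinuum-15932), line `Sketch`, stub `stub_inplaneGain`, helper 4:
# per-site and per-layer bounds for the in-plane contraction (upper sliver, `λ = 199/200`)

Support file for the certified in-plane gain. For the contraction `a ↦ λa`, `Λ = λ² = 39601/40000`, of a layered
set with spacing `a² ∈ [A₁, A₂]` at preserved nearest interlayer bonds, every site term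
`E(a²P + H²) - E(Λa²P + H'²)` of the difference of the site energies is bounded below by an explicit rational
function of `P` (one-sided Taylor bound `ig_taylor` of helper 1, monotonicity in the parameters):

* in-plane sites (`H = H' = 0`): `igNNind(P) · (E(a²) - E(Λa²)) + igRingU A₁ A₂ P` (`ig_site_ringU`);
* sites of the two adjacent layers (`H'² = H² + (1 - Λ)a²/3`): `igAdjU A₁ A₂ P` (`ig_site_adjU`);
* sites of a layer with `H² ∈ [h₁, h₂]`, `H'² ∈ [H², H² + β]`: `igFarU A₁ A₂ h₁ h₂ β P` (`ig_site_farU`).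

Summing over the layer (helper 2) gives the layer bounds `ig_layer_inU`, `ig_layer_adjU`, `ig_layer_farU` (box sum
minus tail) and the generic far-layer bound `ig_layer_genU` used beyond the certified range of layer distances.
-/

noncomputable section

namespace Summit.AtomisticToContinuum.Crystallization.Theorems.CleanHull

open Summit.AtomisticToContinuum.Crystallization.Theorems.LayeredHull
open Literature.MathematicalPhysics.StatisticalMechanics Finset

/-! ## Monotonicity helpers -/

/-- `x ↦ 1 - x⁻³` is nonnegative from `1` on. [folklore] -/
theorem ig_one_sub_inv3_nonneg {x : ℝ} (hx : 1 ≤ x) : 0 ≤ 1 - (x⁻¹) ^ 3 :=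
  sub_nonneg.2 (pow_le_one₀ (by positivity) (inv_le_one_of_one_le₀ hx))

/-- `x ↦ 1 - x⁻³` is increasing on `(0, ∞)`. [folklore] -/
theorem ig_one_sub_inv3_mono {x y : ℝ} (hx : 0 < x) (hxy : x ≤ y) : 1 - (x⁻¹) ^ 3 ≤ 1 - (y⁻¹) ^ 3 := by
  have hy : 0 < y := lt_of_lt_of_le hx hxy
  have : (y⁻¹) ^ 3 ≤ (x⁻¹) ^ 3 := pow_le_pow_left₀ (by positivity) (inv_anti₀ hx hxy) 3
  linarith

/-- The Taylor weight is monotone in its two arguments: for `1 ≤ q'₁ ≤ q'` and `0 < q ≤ q₂`,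
`(1 - q'₁⁻³)/(2 q₂⁴) ≤ (1 - q'⁻³)/(2 q⁴)`. [folklore] -/
theorem ig_weight_mono {q q₂ q' q'₁ : ℝ} (hq : 0 < q) (hq2 : q ≤ q₂) (hq'₁ : 1 ≤ q'₁) (hq' : q'₁ ≤ q') :
    (1 - (q'₁⁻¹) ^ 3) / (2 * q₂ ^ 4) ≤ (1 - (q'⁻¹) ^ 3) / (2 * q ^ 4) :=
  div_le_div₀ (ig_one_sub_inv3_nonneg (hq'₁.trans hq')) (ig_one_sub_inv3_mono (by linarith) hq')
    (by positivity) (by nlinarith [pow_le_pow_left₀ hq.le hq2 4])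

/-! ## Per-site bounds -/

/-- **In-plane sites under the contraction.** [folklore] -/
theorem ig_site_ringU {a A₁ A₂ : ℝ} (hA₁ : 1 / 2 ≤ A₁) (h1 : A₁ ≤ a ^ 2) (h2 : a ^ 2 ≤ A₂) (p : ℤ × ℤ) :
    igNNind (igP 0 p) * (igE (a ^ 2) - igE (39601 / 40000 * a ^ 2)) + igRingU A₁ A₂ (igP 0 p) ≤
      igE (a ^ 2 * igP 0 p) - igE (39601 / 40000 * a ^ 2 * igP 0 p) := by
  rcases ig_P0_trichotomy p with h | h | h
  · rw [h]; norm_num [igNNind, igRingU, ig_E_zero]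
  · rw [h]; norm_num [igNNind, igRingU]
  · set P := igP 0 p with hP
    have hnn : igNNind P = 0 := by unfold igNNind; rw [if_neg (by linarith)]
    rw [hnn, zero_mul, zero_add]
    unfold igRingU
    rw [if_neg (by linarith)]
    have hq'₁ : 1 ≤ 39601 / 40000 * A₁ * P := by nlinarith
    have hq' : 39601 / 40000 * A₁ * P ≤ 39601 / 40000 * a ^ 2 * P := by nlinarith
    have hq : 0 < a ^ 2 * P := by nlinarith
    have hq2 : a ^ 2 * P ≤ A₂ * P := by nlinarith
    have hT := ig_taylor (by nlinarith : 1 ≤ a ^ 2 * P) (hq'₁.trans hq')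
    have hw := ig_weight_mono hq hq2 hq'₁ hq'
    have hw0 : 0 ≤ (1 - ((39601 / 40000 * A₁ * P)⁻¹) ^ 3) / (2 * (A₂ * P) ^ 4) :=
      div_nonneg (ig_one_sub_inv3_nonneg hq'₁) (by positivity)
    have hc : 399 / 40000 * A₁ * P ≤ a ^ 2 * P - 39601 / 40000 * a ^ 2 * P := by nlinarith
    have hc0 : 0 ≤ 399 / 40000 * A₁ * P := by nlinarith
    calc 399 / 40000 * A₁ * P * (1 - ((39601 / 40000 * A₁ * P)⁻¹) ^ 3) / (2 * (A₂ * P) ^ 4)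
        = 399 / 40000 * A₁ * P * ((1 - ((39601 / 40000 * A₁ * P)⁻¹) ^ 3) / (2 * (A₂ * P) ^ 4)) := by ring
      _ ≤ (a ^ 2 * P - 39601 / 40000 * a ^ 2 * P) *
            ((1 - ((39601 / 40000 * a ^ 2 * P)⁻¹) ^ 3) / (2 * (a ^ 2 * P) ^ 4)) :=
          mul_le_mul hc hw hw0 (by linarith)
      _ = (a ^ 2 * P - 39601 / 40000 * a ^ 2 * P) * (1 - ((39601 / 40000 * a ^ 2 * P)⁻¹) ^ 3) /
            (2 * (a ^ 2 * P) ^ 4) := by ring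
      _ ≤ _ := hT

/-- **Adjacent-layer sites under the contraction** (`b = a²/3 + D²` the squared nearest interlayer bond).
[folklore] -/
theorem ig_site_adjU {a b A₁ A₂ : ℝ} (hA₁ : 1 / 2 ≤ A₁) (h1 : A₁ ≤ a ^ 2) (h2 : a ^ 2 ≤ A₂) (hb1 : 81 / 100 ≤ b)
    (hb2 : b ≤ 2601 / 2500) (p : ℤ × ℤ) :
    igAdjU A₁ A₂ (igP 1 p) ≤
      igE (a ^ 2 * (igP 1 p - 1 / 3) + b) - igE (39601 / 40000 * a ^ 2 * (igP 1 p - 1 / 3) + b) := by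
  rcases ig_P1_dichotomy p with h | h
  · rw [h]; norm_num [igAdjU]
  · set x := igP 1 p - 1 / 3 with hx
    have hx1 : 1 ≤ x := by rw [hx]; linarith
    unfold igAdjU
    rw [if_neg (by linarith), ← hx]
    have hq'₁ : 1 ≤ 39601 / 40000 * A₁ * x + 81 / 100 := by nlinarith
    have hq' : 39601 / 40000 * A₁ * x + 81 / 100 ≤ 39601 / 40000 * a ^ 2 * x + b := by nlinarith
    have hq : 0 < a ^ 2 * x + b := by nlinarith
    have hq2 : a ^ 2 * x + b ≤ A₂ * x + 2601 / 2500 := by nlinarith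
    have hT := ig_taylor (by nlinarith : 1 ≤ a ^ 2 * x + b) (hq'₁.trans hq')
    have hw := ig_weight_mono hq hq2 hq'₁ hq'
    have hw0 : 0 ≤ (1 - ((39601 / 40000 * A₁ * x + 81 / 100)⁻¹) ^ 3) / (2 * (A₂ * x + 2601 / 2500) ^ 4) :=
      div_nonneg (ig_one_sub_inv3_nonneg hq'₁) (by positivity)
    have hc : 399 / 40000 * A₁ * x ≤ a ^ 2 * x + b - (39601 / 40000 * a ^ 2 * x + b) := by nlinarith
    calc 399 / 40000 * A₁ * x * (1 - ((39601 / 40000 * A₁ * x + 81 / 100)⁻¹) ^ 3) /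
          (2 * (A₂ * x + 2601 / 2500) ^ 4)
        = 399 / 40000 * A₁ * x * ((1 - ((39601 / 40000 * A₁ * x + 81 / 100)⁻¹) ^ 3) /
            (2 * (A₂ * x + 2601 / 2500) ^ 4)) := by ring
      _ ≤ (a ^ 2 * x + b - (39601 / 40000 * a ^ 2 * x + b)) *
            ((1 - ((39601 / 40000 * a ^ 2 * x + b)⁻¹) ^ 3) / (2 * (a ^ 2 * x + b) ^ 4)) :=
          mul_le_mul hc hw hw0 (by nlinarith)
      _ = (a ^ 2 * x + b - (39601 / 40000 * a ^ 2 * x + b)) * (1 - ((39601 / 40000 * a ^ 2 * x + b)⁻¹) ^ 3) /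
            (2 * (a ^ 2 * x + b) ^ 4) := by ring
      _ ≤ _ := hT

/-- **Far-layer sites under the contraction.** [folklore] -/
theorem ig_site_farU {a h h' A₁ A₂ h₁ h₂ β P : ℝ} (hA₁ : 0 < A₁) (h1 : A₁ ≤ a ^ 2) (h2 : a ^ 2 ≤ A₂)
    (hh1 : h₁ ≤ h) (hh2 : h ≤ h₂) (hh' : h ≤ h') (hh'2 : h' ≤ h + β) (hone : 1 ≤ h₁) (hP : 0 ≤ P) :
    igFarU A₁ A₂ h₁ h₂ β P ≤ igE (a ^ 2 * P + h) - igE (39601 / 40000 * a ^ 2 * P + h') := by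
  set q := a ^ 2 * P + h with hq
  set q' := 39601 / 40000 * a ^ 2 * P + h' with hq'
  have haP : 0 ≤ a ^ 2 * P := by nlinarith
  have hq1 : 1 ≤ q := by rw [hq]; nlinarith
  have hq'lo : 39601 / 40000 * A₁ * P + h₁ ≤ q' := by rw [hq']; nlinarith
  have hq'lo1 : 1 ≤ 39601 / 40000 * A₁ * P + h₁ := by nlinarith
  have hq'hi : q' ≤ 39601 / 40000 * A₂ * P + h₂ + β := by rw [hq']; nlinarith
  have hqlo : A₁ * P + h₁ ≤ q := by rw [hq]; nlinarith
  have hqlo0 : 0 < A₁ * P + h₁ := by nlinarith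
  have hqhi : q ≤ A₂ * P + h₂ := by rw [hq]; nlinarith
  have hT := ig_taylor hq1 (hq'lo1.trans hq'lo)
  set w := (1 - (q'⁻¹) ^ 3) / (2 * q ^ 4) with hw
  have hw0 : 0 ≤ w := div_nonneg (ig_one_sub_inv3_nonneg (hq'lo1.trans hq'lo)) (by positivity)
  have hwlo : (1 - ((39601 / 40000 * A₁ * P + h₁)⁻¹) ^ 3) / (2 * (A₂ * P + h₂) ^ 4) ≤ w :=
    ig_weight_mono (by linarith) hqhi hq'lo1 hq'lo
  have hwhi : w ≤ (1 - ((39601 / 40000 * A₂ * P + h₂ + β)⁻¹) ^ 3) / (2 * (A₁ * P + h₁) ^ 4) :=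
    ig_weight_mono hqlo0 hqlo (hq'lo1.trans hq'lo) hq'hi
  have hcoef : 399 / 40000 * A₁ * P - β ≤ q - q' := by rw [hq, hq']; nlinarith
  have hTw : (q - q') * w ≤ igE q - igE q' := by
    have e : (q - q') * w = (q - q') * (1 - (q'⁻¹) ^ 3) / (2 * q ^ 4) := by rw [hw]; ring
    rw [e]; exact hT
  set c₀ := 399 / 40000 * A₁ * P - β with hc₀
  unfold igFarU
  rw [← hc₀]
  rcases le_or_gt 0 c₀ with hc | hc
  · rw [max_eq_left hc, min_eq_right hc, zero_mul, add_zero]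
    calc c₀ * ((1 - ((39601 / 40000 * A₁ * P + h₁)⁻¹) ^ 3) / (2 * (A₂ * P + h₂) ^ 4)) ≤ c₀ * w :=
          mul_le_mul_of_nonneg_left hwlo hc
      _ ≤ (q - q') * w := mul_le_mul_of_nonneg_right hcoef hw0
      _ ≤ _ := hTw
  · rw [max_eq_right hc.le, min_eq_left hc.le, zero_mul, zero_add]
    calc c₀ * ((1 - ((39601 / 40000 * A₂ * P + h₂ + β)⁻¹) ^ 3) / (2 * (A₁ * P + h₁) ^ 4)) ≤ c₀ * w :=
          mul_le_mul_of_nonpos_left hwhi hc.le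
      _ ≤ (q - q') * w := mul_le_mul_of_nonneg_right hcoef hw0
      _ ≤ _ := hTw

/-- The far-site bound is at least minus the tail majorant `β/(2(A₁P + h₁)⁴)`. [folklore] -/
theorem ig_farU_ge_neg {A₁ A₂ h₁ h₂ β P : ℝ} (hA₁ : 0 < A₁) (hA : A₁ ≤ A₂) (hone : 1 ≤ h₁) (hh : h₁ ≤ h₂)
    (hβ : 0 ≤ β) (hP : 0 ≤ P) :
    -(β / (2 * A₁ ^ 4) * ((P + h₁ / A₁)⁻¹) ^ 4) ≤ igFarU A₁ A₂ h₁ h₂ β P := by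
  unfold igFarU
  have hAP : 0 ≤ A₁ * P := by positivity
  have h1 : 1 ≤ 39601 / 40000 * A₁ * P + h₁ := by nlinarith
  have h2 : 1 ≤ 39601 / 40000 * A₂ * P + h₂ + β := by nlinarith
  have hmax : 0 ≤ max (399 / 40000 * A₁ * P - β) 0 *
      ((1 - ((39601 / 40000 * A₁ * P + h₁)⁻¹) ^ 3) / (2 * (A₂ * P + h₂) ^ 4)) := by
    have := ig_one_sub_inv3_nonneg h1
    have : 0 ≤ A₂ * P + h₂ := by nlinarith
    positivity
  have hmin : -β ≤ min (399 / 40000 * A₁ * P - β) 0 := le_min (by nlinarith) (by linarith)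
  have hmin0 : min (399 / 40000 * A₁ * P - β) 0 ≤ 0 := min_le_right _ _
  set w := (1 - ((39601 / 40000 * A₂ * P + h₂ + β)⁻¹) ^ 3) / (2 * (A₁ * P + h₁) ^ 4) with hw
  have hq0 : 0 < A₁ * P + h₁ := by nlinarith
  have hw0 : 0 ≤ w := div_nonneg (ig_one_sub_inv3_nonneg h2) (by positivity)
  have hw1 : w ≤ 1 / (2 * (A₁ * P + h₁) ^ 4) := by
    rw [hw]
    apply div_le_div_of_nonneg_right _ (by positivity)
    have : 0 ≤ ((39601 / 40000 * A₂ * P + h₂ + β)⁻¹) ^ 3 := by positivity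
    linarith
  have e : β / (2 * A₁ ^ 4) * ((P + h₁ / A₁)⁻¹) ^ 4 = β * (1 / (2 * (A₁ * P + h₁) ^ 4)) := by
    have : P + h₁ / A₁ = (A₁ * P + h₁) / A₁ := by field_simp
    rw [this, inv_div, div_pow]
    field_simp
  rw [e]
  have key : -(β * (1 / (2 * (A₁ * P + h₁) ^ 4))) ≤ min (399 / 40000 * A₁ * P - β) 0 * w := by
    calc -(β * (1 / (2 * (A₁ * P + h₁) ^ 4))) ≤ -(β * w) := by nlinarith [mul_le_mul_of_nonneg_left hw1 hβ]
      _ = (-β) * w := by ring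
      _ ≤ min (399 / 40000 * A₁ * P - β) 0 * w := mul_le_mul_of_nonneg_right hmin hw0
  linarith

/-! ## Per-layer bounds -/

/-- `(199/200 · a)² = Λ a²`. [folklore] -/
theorem ig_lamU_sq (a : ℝ) : (199 / 200 * a) ^ 2 = 39601 / 40000 * a ^ 2 := by ring

/-- **The in-plane layer under the contraction**: `Φ₀(a) - Φ₀(λa)` is at least the nearest-neighbour term times
the number of nearest neighbours in the box plus the certified ring sum. [folklore] -/
theorem ig_layer_inU {a A₁ A₂ : ℝ} (hA₁ : 1 / 2 ≤ A₁) (h1 : A₁ ≤ a ^ 2) (h2 : a ^ 2 ≤ A₂) {N : ℕ} (hN : 1 ≤ N) :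
    (igE (a ^ 2) - igE (39601 / 40000 * a ^ 2)) * ∑ p ∈ igBox N, igNNind (igP 0 p) +
        ∑ p ∈ igBox N, igRingU A₁ A₂ (igP 0 p) ≤
      inLayerInteraction lennardJones a - inLayerInteraction lennardJones (199 / 200 * a) := by
  have ha : 0 < a ^ 2 := by linarith
  have hs1 := ig_summable_site ha le_rfl 0 (Or.inl rfl)
  have hs2 := ig_summable_site (by positivity : (0 : ℝ) < 39601 / 40000 * a ^ 2) le_rfl 0 (Or.inl rfl)
  rw [ig_inLayer_eq, ig_inLayer_eq, ig_lamU_sq]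
  simp only [add_zero] at hs1 hs2
  rw [← Summable.tsum_sub hs1 hs2, mul_sum, ← sum_add_distrib]
  refine ig_box_le_tsum (hs1.sub hs2) (fun p _ => ?_) (fun p hp => ?_)
  · have := ig_site_ringU hA₁ h1 h2 p
    linarith
  · have hle := ig_site_ringU hA₁ h1 h2 p
    have hr := ig_not_mem_igBox hp
    have hs := ig_P0_ge_shell p (by omega)
    have hr2 : (2 : ℝ) ≤ ((max |p.1| |p.2| : ℤ) : ℝ) := by exact_mod_cast (show (2 : ℤ) ≤ _ by omega)
    have hP3 : 5 / 2 ≤ igP 0 p := by nlinarith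
    have hnn : igNNind (igP 0 p) = 0 := by unfold igNNind; rw [if_neg (by linarith)]
    have hring : 0 ≤ igRingU A₁ A₂ (igP 0 p) := by
      unfold igRingU
      rw [if_neg (by linarith)]
      have : 1 ≤ 39601 / 40000 * A₁ * igP 0 p := by nlinarith
      have := ig_one_sub_inv3_nonneg this
      have : 0 ≤ A₂ := by linarith
      have : 0 ≤ A₁ := by linarith
      positivity
    rw [hnn, zero_mul, zero_add] at hle
    linarith

/-- **An adjacent layer under the contraction** (`D'² = D² + (1 - Λ)a²/3` keeps the three nearest bonds).
[folklore] -/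
theorem ig_layer_adjU {a D D' A₁ A₂ : ℝ} (hA₁ : 1 / 2 ≤ A₁) (h1 : A₁ ≤ a ^ 2) (h2 : a ^ 2 ≤ A₂)
    (hD' : D' ^ 2 = D ^ 2 + a ^ 2 * (1 - (199 / 200 : ℝ) ^ 2) / 3) (hb1 : 81 / 100 ≤ a ^ 2 / 3 + D ^ 2)
    (hb2 : a ^ 2 / 3 + D ^ 2 ≤ 2601 / 2500) (N : ℕ) :
    ∑ p ∈ igBox N, igAdjU A₁ A₂ (igP 1 p) ≤
      layerInteraction lennardJones a D 1 1 - layerInteraction lennardJones (199 / 200 * a) D' 1 1 := by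
  have ha : 0 < a ^ 2 := by linarith
  have hane : a ≠ 0 := by rintro rfl; norm_num at ha
  have hs1 := ig_summable_layer hane D 1 (Or.inr rfl)
  have hs2 := ig_summable_layer (show 199 / 200 * a ≠ 0 from mul_ne_zero (by norm_num) hane) D' 1 (Or.inr rfl)
  rw [ig_LI_eq, ig_LI_eq, ← Summable.tsum_sub hs1 hs2]
  have hsite : ∀ p : ℤ × ℤ, igAdjU A₁ A₂ (igP 1 p) ≤
      igE (a ^ 2 * igP 1 p + D ^ 2) - igE ((199 / 200 * a) ^ 2 * igP 1 p + D' ^ 2) := by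
    intro p
    have e1 : a ^ 2 * igP 1 p + D ^ 2 = a ^ 2 * (igP 1 p - 1 / 3) + (a ^ 2 / 3 + D ^ 2) := by ring
    have e2 : (199 / 200 * a) ^ 2 * igP 1 p + D' ^ 2 =
        39601 / 40000 * a ^ 2 * (igP 1 p - 1 / 3) + (a ^ 2 / 3 + D ^ 2) := by rw [hD']; ring
    rw [e1, e2]
    exact ig_site_adjU hA₁ h1 h2 hb1 hb2 p
  have hnonneg : ∀ p : ℤ × ℤ, 0 ≤ igAdjU A₁ A₂ (igP 1 p) := by
    intro p
    unfold igAdjU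
    split_ifs with h
    · exact le_rfl
    · have h' : 1 ≤ igP 1 p := not_lt.1 h
      have : 1 ≤ 39601 / 40000 * A₁ * (igP 1 p - 1 / 3) + 81 / 100 := by nlinarith
      have := ig_one_sub_inv3_nonneg this
      have : 0 ≤ A₂ * (igP 1 p - 1 / 3) + 2601 / 2500 := by nlinarith
      have : 0 ≤ igP 1 p - 1 / 3 := by linarith
      have : 0 ≤ A₁ := by linarith
      positivity
  exact ig_box_le_tsum (hs1.sub hs2) (fun p _ => hsite p) (fun p _ => (hnonneg p).trans (hsite p))

/-- **A far layer under the contraction**: box certificate minus the tail of the majorant `β/(2(A₁P + h₁)⁴)`.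
[folklore] -/
theorem ig_layer_farU {a H H' A₁ A₂ h₁ h₂ β : ℝ} (δ : ℤ) (hδ : δ = 0 ∨ δ = 1) (hA₁ : 0 < A₁) (h1 : A₁ ≤ a ^ 2)
    (h2 : a ^ 2 ≤ A₂) (hh1 : h₁ ≤ H ^ 2) (hh2 : H ^ 2 ≤ h₂) (hH' : H ^ 2 ≤ H' ^ 2) (hH'2 : H' ^ 2 ≤ H ^ 2 + β)
    (hβ : 0 ≤ β) (hone : 1 ≤ h₁) {N : ℕ} (hN : 1 ≤ N) :
    ∑ p ∈ igBox N, igFarU A₁ A₂ h₁ h₂ β (igP δ p) -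
        32 * ((N : ℝ) + 1) / (3 * (6 * N + 1)) * (β / (2 * A₁ ^ 4)) *
          ((3 / 4 * ((N : ℝ) - 1 / 3) ^ 2 + h₁ / A₁)⁻¹) ^ 3 ≤
      layerInteraction lennardJones a H δ 1 - layerInteraction lennardJones (199 / 200 * a) H' δ 1 := by
  have ha : 0 < a ^ 2 := by linarith
  have hane : a ≠ 0 := by rintro rfl; norm_num at ha
  have hs1 := ig_summable_layer hane H δ hδ
  have hs2 := ig_summable_layer (show 199 / 200 * a ≠ 0 from mul_ne_zero (by norm_num) hane) H' δ hδ
  rw [ig_LI_eq, ig_LI_eq, ← Summable.tsum_sub hs1 hs2]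
  have hT : 0 < h₁ / A₁ := by positivity
  obtain ⟨hns, hnle⟩ := ig_tail_inv_pow δ hδ (show 0 ≤ β / (2 * A₁ ^ 4) by positivity) hT (n := 3) hN (by norm_num)
  have hsite : ∀ p : ℤ × ℤ, igFarU A₁ A₂ h₁ h₂ β (igP δ p) ≤
      igE (a ^ 2 * igP δ p + H ^ 2) - igE ((199 / 200 * a) ^ 2 * igP δ p + H' ^ 2) := fun p => by
    rw [ig_lamU_sq]
    exact ig_site_farU hA₁ h1 h2 hh1 hh2 hH' hH'2 hone (igP_nonneg δ p)
  have e3 : ((3 : ℕ) : ℝ) = 3 := by norm_num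
  rw [e3] at hnle
  refine ig_box_tail (hs1.sub hs2) hns (fun p _ => hsite p) (fun p _ => ?_) hnle
  exact (ig_farU_ge_neg hA₁ (h1.trans h2) hone (hh1.trans hh2) hβ (igP_nonneg δ p)).trans (hsite p)

/-- **The generic far-layer bound under the contraction** (no certificate): the difference is at least
`-(β/(2A₁⁴))(9 T⁻⁴ + (64/21)(1/3 + T)⁻³)` with `T = h₁/A₁`. [folklore] -/
theorem ig_layer_genU {a H H' A₁ A₂ h₁ h₂ β : ℝ} (δ : ℤ) (hδ : δ = 0 ∨ δ = 1) (hA₁ : 0 < A₁) (h1 : A₁ ≤ a ^ 2)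
    (h2 : a ^ 2 ≤ A₂) (hh1 : h₁ ≤ H ^ 2) (hh2 : H ^ 2 ≤ h₂) (hH' : H ^ 2 ≤ H' ^ 2) (hH'2 : H' ^ 2 ≤ H ^ 2 + β)
    (hβ : 0 ≤ β) (hone : 1 ≤ h₁) :
    -(β / (2 * A₁ ^ 4) * (9 * ((h₁ / A₁)⁻¹) ^ 4 + 64 / 21 * ((1 / 3 + h₁ / A₁)⁻¹) ^ 3)) ≤
      layerInteraction lennardJones a H δ 1 - layerInteraction lennardJones (199 / 200 * a) H' δ 1 := by
  have ha : 0 < a ^ 2 := by linarith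
  have hane : a ≠ 0 := by rintro rfl; norm_num at ha
  have hs1 := ig_summable_layer hane H δ hδ
  have hs2 := ig_summable_layer (show 199 / 200 * a ≠ 0 from mul_ne_zero (by norm_num) hane) H' δ hδ
  rw [ig_LI_eq, ig_LI_eq, ← Summable.tsum_sub hs1 hs2]
  have hT : 0 < h₁ / A₁ := by positivity
  obtain ⟨hns, hnle⟩ := ig_tsum_inv4_le δ hδ hT
  have hC : 0 ≤ β / (2 * A₁ ^ 4) := by positivity
  have hsite : ∀ p : ℤ × ℤ, -(β / (2 * A₁ ^ 4) * ((igP δ p + h₁ / A₁)⁻¹) ^ 4) ≤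
      igE (a ^ 2 * igP δ p + H ^ 2) - igE ((199 / 200 * a) ^ 2 * igP δ p + H' ^ 2) := fun p => by
    rw [ig_lamU_sq]
    exact (ig_farU_ge_neg hA₁ (h1.trans h2) hone (hh1.trans hh2) hβ (igP_nonneg δ p)).trans
      (ig_site_farU hA₁ h1 h2 hh1 hh2 hH' hH'2 hone (igP_nonneg δ p))
  have h3 := Summable.tsum_le_tsum hsite (hns.mul_left _).neg (hs1.sub hs2)
  rw [tsum_neg, tsum_mul_left] at h3
  have h4 := mul_le_mul_of_nonneg_left hnle hC
  linarith

end Summit.AtomisticToContinuum.Crystallization.Theorems.CleanHull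

end
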